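import Literature.Geometry.Riemannian.WeylEnergy
import Literature.Geometry.Riemannian.ConstantCurvature
import Literature.Geometry.Riemannian.RicciFlowScalarCurvatureProofs
import Literature.Geometry.Lorentzian.LeviCivitaCurvature
import HarnessLib

/-!
# An Einstein `4`-manifold with vanishing Weyl tensor has constant sectional curvature (proved)

Topic `Literature/Geometry/Riemannian`. The pointwise algebra behind the first alternative of the
Einstein gap theorem of `GurskyEinsteinGap.lean` (cite item wi-16612, route
`SmoothPoincare4/EntropyRung`, crux `CompactShrinkerGap`): by the orthogonal decomposition of the
curvature tensor (Besse 1987, 1.114–1.118: `R = (s/(2n(n-1))) g ⊙ g + (1/(n-2)) z ⊙ g + W`,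
`z = r - (s/n) g`; in dimension `4` Chang–Gursky–Yang 2003, (0.1):
`Riem = W + ½ E ⊙ g + (1/24) R g ⊙ g`, `E = Ric - ¼ R g`), a metric with `z = 0` (Einstein) and
`W = 0` has `R = (s/(2n(n-1))) g ⊙ g`, i.e. constant sectional curvature `s/(n(n-1))`; for
`Ric = λ g` in dimension `4`, `s = 4λ` and the sectional curvature is `λ/3` (the round `S⁴` of
radius `1` has `Ric = 3g`, `K = 1`). Everything here is PROVED over the tree's vocabulary:

* `scalarCurvature_eq_of_ricci_eq` — `Ric = λ g` on a Riemannian manifold modelled on `E`,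
  `dim E = m`, gives `S = m λ` (trace in a `g_x`-orthonormal basis,
  `trace_eq_sum_of_isOrthonormalFrame`);
* `hasConstantSectionalCurvatureWith_of_ricci_eq_of_weylFrame_eq_zero` — on a Riemannian manifold
  modelled on a `4`-dimensional space, `Ric = λ g` and the vanishing of all orthonormal-frame
  components `W_{ijkl}` of the Weyl tensor (`PseudoRiemannianMetric.weylFrame`, `WeylEnergy.lean`)
  give `Rm(X, Y, Z, W) = (λ/3) (g(Y,Z) g(X,W) - g(X,Z) g(Y,W))` for the Levi-Civita connection
  `g.leviCivita`, i.e. `g.HasConstantSectionalCurvatureWith g.leviCivita (λ/3)`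
  (`ConstantCurvature.lean`): on an orthonormal basis this is `weylFrame_fin_four` with
  `Ric_{ab} = λ δ_{ab}`, `S = 4λ`; the identity extends to all vectors by `4`-linearity of both
  sides (expansion in the basis, one slot at a time);
* `hasConstantSectionalCurvature_of_ricci_eq_of_weylFrame_eq_zero` — the same for EVERY
  Levi-Civita connection of `g` (`g.HasConstantSectionalCurvature (λ/3)`), their curvature tensors
  being `g.riemann` (`IsLeviCivita.curvature_eq_riemann`, `LeviCivitaCurvature.lean`).

No named facts. Imports: `WeylEnergy` (frame Weyl tensor), `ConstantCurvature`,
`RicciFlowScalarCurvatureProofs` (orthonormal bases: `exists_basis_isOrthonormalFrame`,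
`trace_eq_sum_of_isOrthonormalFrame`), `LeviCivitaCurvature`.

## References

* A. L. Besse, *Einstein Manifolds* (1987), 1.114–1.118 (decomposition of the curvature tensor;
  `W = 0` and `z = 0` leave the constant-curvature part), 1.119. [Besse1987]
* S.-Y. A. Chang, M. J. Gursky, P. C. Yang, Publ. Math. IHÉS 98 (2003), (0.1). [ChangGurskyYang2003]
* J. M. Lee, *Introduction to Riemannian Manifolds*, 2nd ed. (2018), Prop. 8.36 (constant
  sectional curvature `c` iff `Rm = (c/2) g ⊙ g`). [Lee2018]
-/

noncomputable section

open Bundle Module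
open scoped Manifold ContDiff Topology

namespace Literature.Geometry.Riemannian

open Literature.Geometry.Lorentzian (PseudoRiemannianMetric)
open Literature.Geometry.Lorentzian.PseudoRiemannianMetric

variable {E : Type*} [NormedAddCommGroup E] [NormedSpace ℝ E] {H : Type*} [TopologicalSpace H]
  {I : ModelWithCorners ℝ E H} {M : Type*} [TopologicalSpace M] [ChartedSpace H M]
  [IsManifold I ∞ M] {n : ℕ∞ω} [FiniteDimensional ℝ E]

variable (g : PseudoRiemannianMetric I n E (TangentSpace I : M → Type _)) [g.HasLeviCivita]

/-! ### A linear functional vanishing on a basis vanishes -/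

omit [IsManifold I ∞ M] [FiniteDimensional ℝ E] in
/-- A function `φ : V → ℝ` which is additive and homogeneous and vanishes on a basis vanishes
identically (the basis expansion; used below one slot at a time). [folklore] -/
private theorem eq_zero_of_forall_basis {V : Type*} [AddCommGroup V] [Module ℝ V] {ι : Type*}
    (b : Basis ι ℝ V) {φ : V → ℝ} (hadd : ∀ v w, φ (v + w) = φ v + φ w)
    (hsmul : ∀ (a : ℝ) (v : V), φ (a • v) = a * φ v) (hb : ∀ i, φ (b i) = 0) (v : V) :
    φ v = 0 := by
  let L : V →ₗ[ℝ] ℝ :=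
    { toFun := φ
      map_add' := hadd
      map_smul' := fun a v ↦ by rw [hsmul, smul_eq_mul, RingHom.id_apply] }
  have hL : L = 0 := b.ext fun i ↦ by simpa [L] using hb i
  simpa [L] using LinearMap.congr_fun hL v

/-! ### `Ric = λ g` gives `S = (dim M) λ` -/

/-- **The scalar curvature of an Einstein metric**: if `g` is Riemannian with `Ric = λ g` and the
model space has dimension `m`, then `S = m λ` at every point (`S = tr_g Ric = Σᵢ Ric(bᵢ, bᵢ)` in a
`g_x`-orthonormal basis, O'Neill 1983, Def. 3.53). [cite: Besse1987, 1.118] -/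
theorem scalarCurvature_eq_of_ricci_eq (hg : g.IsRiemannian) {m : ℕ} (hm : finrank ℝ E = m)
    {lam : ℝ} (hRic : ∀ (x : M) (X Y : TangentSpace I x), g.ricci x X Y = lam * g.val x X Y)
    (x : M) : g.scalarCurvature x = m * lam := by
  obtain ⟨b, hb⟩ := g.exists_basis_isOrthonormalFrame (hg x) hm
  rw [scalarCurvature, g.trace_eq_sum_of_isOrthonormalFrame b hb]
  simp only [hRic, hb.1, mul_one, Finset.sum_const, Finset.card_univ, Fintype.card_fin,
    nsmul_eq_mul]

/-! ### Einstein and `W = 0` give constant sectional curvature `λ/3` in dimension `4` -/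

/-- **An Einstein metric with vanishing Weyl tensor on a `4`-manifold has constant sectional
curvature** (Besse 1987, 1.114–1.118: `R = (s/24) g ⊙ g + ½ z ⊙ g + W` in dimension `4`, so
`z = 0` and `W = 0` give `R = (s/24) g ⊙ g`, constant curvature `s/12 = λ/3` for `Ric = λ g`). Over
the tree's vocabulary: `g` Riemannian on a manifold modelled on a `4`-dimensional space, with
`Ric = λ g` and all orthonormal-frame Weyl components `W_{ijkl}` (`weylFrame`) zero; then the
Levi-Civita connection `g.leviCivita` has
`Rm(X, Y, Z, W) = (λ/3) (g(Y,Z) g(X,W) - g(X,Z) g(Y,W))` (`HasConstantSectionalCurvatureWith`).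
Proof: on a `g_x`-orthonormal basis this is `weylFrame_fin_four` with `Ric_{ab} = λ δ_{ab}` and
`S = 4λ`; both sides are `4`-linear, so the identity extends from the basis to all vectors.
[cite: Besse1987, 1.116–1.118] [cite: ChangGurskyYang2003, (0.1)] [cite: Lee2018, Prop. 8.36] -/
theorem hasConstantSectionalCurvatureWith_of_ricci_eq_of_weylFrame_eq_zero (hg : g.IsRiemannian)
    (h4 : finrank ℝ E = 4) {lam : ℝ}
    (hRic : ∀ (x : M) (X Y : TangentSpace I x), g.ricci x X Y = lam * g.val x X Y)
    (hW : ∀ (x : M) (e : Fin 4 → TangentSpace I x), g.IsOrthonormalFrame x e →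
      ∀ i j k l, g.weylFrame x e i j k l = 0) :
    g.HasConstantSectionalCurvatureWith g.leviCivita (lam / 3) := by
  intro x X Y Z W
  obtain ⟨b, hb⟩ := g.exists_basis_isOrthonormalFrame (hg x) h4
  have hS : g.scalarCurvature x = 4 * lam := by
    have := scalarCurvature_eq_of_ricci_eq g hg h4 hRic x
    simpa using this
  have hδ : ∀ a c : Fin 4, g.val x (b a) (b c) = if a = c then 1 else 0 := by
    intro a c
    by_cases hac : a = c
    · subst hac; simp [hb.1 a]
    · simp [hac, hb.2 a c hac]
  -- the difference of the two sides, as a function of four vectors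
  set F : TangentSpace I x → TangentSpace I x → TangentSpace I x → TangentSpace I x → ℝ :=
    fun X Y Z W ↦ g.curvatureForm g.leviCivita x X Y Z W -
      lam / 3 * (g.val x Y Z * g.val x X W - g.val x X Z * g.val x Y W) with hF
  suffices hF0 : ∀ X Y Z W, F X Y Z W = 0 by
    have := hF0 X Y Z W
    simp only [hF] at this
    linarith
  -- (A) on the basis: `weylFrame_fin_four` with `Ric = λ δ`, `S = 4λ`
  have hA : ∀ i j k l, F (b i) (b j) (b k) (b l) = 0 := by
    intro i j k l
    have h := hW x b hb i j k l
    rw [weylFrame_fin_four] at h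
    simp only [hRic, hδ, hS] at h
    simp only [hF, hδ]
    linear_combination h
  -- linearity of `F` in each slot
  have hadd₄ : ∀ X Y Z W W', F X Y Z (W + W') = F X Y Z W + F X Y Z W' := by
    intro X Y Z W W'; simp only [hF, curvatureForm, map_add]; ring
  have hsmul₄ : ∀ X Y Z (a : ℝ) W, F X Y Z (a • W) = a * F X Y Z W := by
    intro X Y Z a W; simp only [hF, curvatureForm, map_smul, smul_eq_mul]; ring
  have hadd₃ : ∀ X Y Z Z' W, F X Y (Z + Z') W = F X Y Z W + F X Y Z' W := by
    intro X Y Z Z' W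
    simp only [hF, curvatureForm, map_add, add_apply]; ring
  have hsmul₃ : ∀ X Y (a : ℝ) Z W, F X Y (a • Z) W = a * F X Y Z W := by
    intro X Y a Z W
    simp only [hF, curvatureForm, map_smul, smul_apply, smul_eq_mul]; ring
  have hadd₂ : ∀ X Y Y' Z W, F X (Y + Y') Z W = F X Y Z W + F X Y' Z W := by
    intro X Y Y' Z W
    simp only [hF, curvatureForm, map_add, add_apply]; ring
  have hsmul₂ : ∀ X (a : ℝ) Y Z W, F X (a • Y) Z W = a * F X Y Z W := by
    intro X a Y Z W
    simp only [hF, curvatureForm, map_smul, smul_apply, smul_eq_mul]; ring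
  have hadd₁ : ∀ X X' Y Z W, F (X + X') Y Z W = F X Y Z W + F X' Y Z W := by
    intro X X' Y Z W
    simp only [hF, curvatureForm, map_add, add_apply]; ring
  have hsmul₁ : ∀ (a : ℝ) X Y Z W, F (a • X) Y Z W = a * F X Y Z W := by
    intro a X Y Z W
    simp only [hF, curvatureForm, map_smul, smul_apply, smul_eq_mul]; ring
  -- (B)–(E): extend from the basis, one slot at a time
  have hB : ∀ i j k W, F (b i) (b j) (b k) W = 0 := fun i j k ↦
    eq_zero_of_forall_basis b (hadd₄ _ _ _) (hsmul₄ _ _ _) (hA i j k)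
  have hC : ∀ i j Z W, F (b i) (b j) Z W = 0 := fun i j Z W ↦
    eq_zero_of_forall_basis b (φ := fun Z ↦ F (b i) (b j) Z W) (fun Z Z' ↦ hadd₃ _ _ Z Z' W)
      (fun a Z ↦ hsmul₃ _ _ a Z W) (fun k ↦ hB i j k W) Z
  have hD : ∀ i Y Z W, F (b i) Y Z W = 0 := fun i Y Z W ↦
    eq_zero_of_forall_basis b (φ := fun Y ↦ F (b i) Y Z W) (fun Y Y' ↦ hadd₂ _ Y Y' Z W)
      (fun a Y ↦ hsmul₂ _ a Y Z W) (fun j ↦ hC i j Z W) Y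
  intro X Y Z W
  exact eq_zero_of_forall_basis b (φ := fun X ↦ F X Y Z W) (fun X X' ↦ hadd₁ X X' Y Z W)
    (fun a X ↦ hsmul₁ a X Y Z W) (fun i ↦ hD i Y Z W) X

/-- **The same for every Levi-Civita connection of `g`** (`HasConstantSectionalCurvature`, the
`∀ cov, g.IsLeviCivita cov → …` phrasing of `ConstantCurvature.lean`): the curvature tensor of any
torsion-free `g`-compatible connection of a `C^n` metric, `n ≥ 2`, is `g.riemann`
(`IsLeviCivita.curvature_eq_riemann`). [cite: Besse1987, 1.116–1.118] [cite: Lee2018, Prop. 8.36] -/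
theorem hasConstantSectionalCurvature_of_ricci_eq_of_weylFrame_eq_zero [CompleteSpace E]
    [Fact (1 ≤ n)] (hn : 2 ≤ n) (hg : g.IsRiemannian) (h4 : finrank ℝ E = 4) {lam : ℝ}
    (hRic : ∀ (x : M) (X Y : TangentSpace I x), g.ricci x X Y = lam * g.val x X Y)
    (hW : ∀ (x : M) (e : Fin 4 → TangentSpace I x), g.IsOrthonormalFrame x e →
      ∀ i j k l, g.weylFrame x e i j k l = 0) :
    g.HasConstantSectionalCurvature (lam / 3) := by
  intro cov hcov x X Y Z W
  have h := hasConstantSectionalCurvatureWith_of_ricci_eq_of_weylFrame_eq_zero g hg h4 hRic hW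
    x X Y Z W
  simp only [curvatureForm] at h ⊢
  rw [hcov.curvature_eq_riemann hn x]
  exact h

end Literature.Geometry.Riemannian

end
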